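import Summits.QuantumFields.YangMills.Theorems.LuscherReductionTraceDoorBasics
import Summits.QuantumFields.YangMills.Theorems.LuscherReductionTraceDoorInvAtoms
import Summits.QuantumFields.YangMills.Theorems.LuscherReductionRunningReductionLevelGapSummable
import HarnessLib

/-!
# `TraceDoorGlue` (stmt-QuantumFields-20206) landing — «OST»: `OneSiteLevels → LevelGapSummable → OneSiteTail → OneSiteTraceLimit` (skeleton PART 8)

Route `LuscherReduction` (owner ym-beyond-p1), RED `RunningReduction` (stmt-QuantumFields-19978) split (route rev 11/12) along the TT door of the
registered skeleton «KTR» rev 8 (`pub/ym-beyond/p1-g19-files/Lines-KTR-r8.lean`, sha16 4d4e029b06d8e70b); glue item `TraceDoorGlue`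
(stmt-QuantumFields-20206) = `TraceFormula → TwistedTraceScaling → OneSiteTail → DressedRitz → RunningReduction`, landed under `Theorems/` as the
file family `LuscherReductionTraceDoor{Defs,Enclosure,Basics,InvAtoms,KT,InvPrep,OST,Glue}.lean` (namespace `…Theorems.FemtoTransferGap.TraceDoor`),
skeleton parts re-homed VERBATIM with the four children taken as the ROUTE DECLS (hypotheses), the skeleton's `Prop` currencies
(`CoarseNoIntruder`, `OneSiteLowerCoarse`, `CoarseLevels`, `OneSiteTraceLimit`) spelled out as texts, the door / Ritz basics / `LevelGapSummable` / ONE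
taken from the tree (`KTDoorR3.katoTempleDoorR3`, `KTDoorR3.ritzBasicsR3`, `LGS.levelGapSummable_all`, `oneSiteLevels_proof`).

THIS FILE (skeleton PART 8 «OST», VERBATIM with the tail hypothesis = the route child `Theses.LuscherReduction.OneSiteTail`, stmt-QuantumFields-20204,
BY NAME): `OST.tsum_shift_le`, `OST.term_close` (termwise limit `x_k(B)^T → e^{−sΔ_k}` from ONE with explicit thresholds via `bareLambda_le_of_le`),
`OST.moment_close` (uniform moment limit: finite part termwise, tails from `OneSiteTail` and from `LevelGapSummable`), `OST.oneSiteTraceLimit_of_ONE`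
(ratio by `ratio_sub_ratio_le`), and the unconditional-in-ONE corollary `oneSiteTraceLimit_of_oneSiteTail : OneSiteTail → ⟨OneSiteTraceLimit text⟩`
(ONE = `oneSiteLevels_proof`, `LevelGapSummable` = `LGS.levelGapSummable_all`).

HONEST FRAMING: elementary real analysis serving the femto rung R2b1; nothing of ONE, of the tail bound, or of the RG is proved here; not a gap, not Clay.
-/

set_option autoImplicit false

noncomputable section

open MeasureTheory Filter Topology Real
open Literature.MathematicalPhysics.QuantumFieldTheory hiding SU2
open Literature.MathematicalPhysics.QuantumLattice
open Literature.Analysis.OperatorTheory.YMMatrixModel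
open scoped BigOperators

namespace Summit.QuantumFields.YangMills.Theorems.FemtoTransferGap.TraceDoor

open Summit.QuantumFields.YangMills.Theorems.FemtoTransferGap
open Summit.QuantumFields.YangMills.Theorems.FemtoTransferGap.TT (physTrace)

namespace OST

/-- Tails of a nonnegative summable sequence decrease under further shifts. -/
theorem tsum_shift_le {f : ℕ → ℝ} (hf : Summable f) (h0 : ∀ k, 0 ≤ f k) (K d : ℕ) :
    ∑' k, f (k + (K + d)) ≤ ∑' k, f (k + K) := by
  have hg : Summable (fun k => f (k + K)) := (summable_nat_add_iff K).2 hf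
  have h := hg.sum_add_tsum_nat_add d
  have h1 : (fun k => f (k + (K + d))) = fun i => f (i + d + K) := by
    funext i; congr 1; omega
  have h2 : 0 ≤ ∑ i ∈ Finset.range d, f (i + K) := Finset.sum_nonneg fun i _ => h0 _
  rw [h1]
  linarith

/-- **Termwise limit from ONE.**  For each level `k`: `|x_k(B)^T − e^{−sΔ_k}| ≤ ε` for `B ≥ B1(k,s,ε)` and every `T` with `|Tλ_b − s| ≤ 2λ_b`. -/
theorem term_close (hONE : Summit.QuantumFields.YangMills.Theses.LuscherReduction.OneSiteLevels) (k : ℕ)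
    {s : ℝ} (hs : 0 < s) {ε : ℝ} (hε : 0 < ε) :
    ∃ B1 : ℝ, ∀ B : ℝ, B1 ≤ B → ∀ T : ℕ, |(T : ℝ) * bareLambda B - s| ≤ 2 * bareLambda B →
      |(levelValue su2Rep 1 B k / levelValue su2Rep 1 B 0) ^ T - Real.exp (-s * levelGap k)| ≤ ε := by
  obtain ⟨C, B0, h⟩ := hONE k
  have hΔ : 0 ≤ levelGap k := levelGap_nonneg k
  set A : ℝ := 2 * levelGap k + |C| * (s + 2) + 1 with hA
  have hApos : 0 < A := by positivity
  have hA1 : 1 ≤ A := by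
    have : 0 ≤ 2 * levelGap k + |C| * (s + 2) := by positivity
    linarith
  set τ : ℝ := min 1 (ε / 2) / A with hτ
  have hmpos : 0 < min 1 (ε / 2) := lt_min one_pos (by positivity)
  have hτpos : 0 < τ := div_pos hmpos hApos
  have hτA : τ * A = min 1 (ε / 2) := by rw [hτ]; field_simp
  have hτle1 : τ ≤ 1 := by
    have h1 : τ ≤ 1 / A := div_le_div_of_nonneg_right (min_le_left _ _) hApos.le
    have h2 : 1 / A ≤ 1 := by rw [div_le_one hApos]; exact hA1
    exact h1.trans h2
  refine ⟨max B0 (max 1 (2 / τ ^ 3)), fun B hB T hT => ?_⟩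
  have hB0 : B0 ≤ B := le_trans (le_max_left _ _) hB
  have hB1 : 1 ≤ B := le_trans ((le_max_left _ _).trans (le_max_right _ _)) hB
  have hBτ : 2 / τ ^ 3 ≤ B := le_trans ((le_max_right _ _).trans (le_max_right _ _)) hB
  have hlpos : 0 < bareLambda B := bareLambda_pos' (by linarith)
  have hlτ : bareLambda B ≤ τ := bareLambda_le_of_le hτpos hBτ
  have hl1 : bareLambda B ≤ 1 := hlτ.trans hτle1
  obtain ⟨hpos0, hup, hlow⟩ := h B hB0
  set l := bareLambda B with hl
  set Δ := levelGap k with hΔdef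
  set x := levelValue su2Rep 1 B k / levelValue su2Rep 1 B 0 with hx
  have hxup : x ≤ Real.exp (-(Δ * l - C * l ^ 2)) := by
    rw [hx, div_le_iff₀ hpos0]; exact hup
  have hxlow : Real.exp (-(Δ * l + C * l ^ 2)) ≤ x := by
    rw [hx, le_div_iff₀ hpos0]; exact hlow
  have hxpos : 0 < x := lt_of_lt_of_le (Real.exp_pos _) hxlow
  have hTup : x ^ T ≤ Real.exp (-(Δ * l - C * l ^ 2)) ^ T := pow_le_pow_left₀ hxpos.le hxup T
  have hTlow : Real.exp (-(Δ * l + C * l ^ 2)) ^ T ≤ x ^ T := pow_le_pow_left₀ (Real.exp_pos _).le hxlow T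
  rw [← Real.exp_nat_mul] at hTup hTlow
  have hu1 : (T : ℝ) * l ≤ s + 2 * l := by have := (abs_le.1 hT).2; linarith
  have hu2 : s - 2 * l ≤ (T : ℝ) * l := by have := (abs_le.1 hT).1; linarith
  have hu0 : 0 ≤ (T : ℝ) * l := by positivity
  -- ρ := l (2Δ + |C|(s+2)) ≤ τ A - τ ≤ min 1 (ε/2)
  set ρ : ℝ := l * (2 * Δ + |C| * (s + 2)) with hρ
  have hρ0 : 0 ≤ ρ := by positivity
  have hρle : ρ ≤ min 1 (ε / 2) := by
    have h1 : ρ ≤ τ * (2 * Δ + |C| * (s + 2)) := mul_le_mul_of_nonneg_right hlτ (by positivity)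
    have h2 : τ * (2 * Δ + |C| * (s + 2)) ≤ τ * A := by
      refine mul_le_mul_of_nonneg_left ?_ hτpos.le
      rw [hA]; linarith
    linarith [hτA]
  have hρ1 : ρ ≤ 1 := hρle.trans (min_le_left _ _)
  have hρε : ρ ≤ ε / 2 := hρle.trans (min_le_right _ _)
  have hρexp : ρ = 2 * l * Δ + |C| * (s + 2) * l := by rw [hρ]; ring
  -- |C (T l) l| ≤ |C| (s+2) l
  have hC1 : C * ((T : ℝ) * l) * l ≤ |C| * (s + 2) * l := by
    refine mul_le_mul_of_nonneg_right ?_ hlpos.le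
    calc C * ((T : ℝ) * l) ≤ |C| * ((T : ℝ) * l) := mul_le_mul_of_nonneg_right (le_abs_self C) hu0
      _ ≤ |C| * (s + 2) := mul_le_mul_of_nonneg_left (by linarith) (abs_nonneg C)
  have hC2 : -(|C| * (s + 2) * l) ≤ C * ((T : ℝ) * l) * l := by
    have h3 : -(|C| * ((T : ℝ) * l)) ≤ C * ((T : ℝ) * l) := by
      have h5 := mul_le_mul_of_nonneg_right (neg_abs_le C) hu0
      linarith [h5, neg_mul (|C|) ((T : ℝ) * l)]
    have h4 : |C| * ((T : ℝ) * l) ≤ |C| * (s + 2) := mul_le_mul_of_nonneg_left (by linarith) (abs_nonneg C)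
    have h6 := mul_le_mul_of_nonneg_right h3 hlpos.le
    have h7 := mul_le_mul_of_nonneg_right h4 hlpos.le
    rw [neg_mul] at h6
    linarith
  have hD1 : s * Δ - 2 * l * Δ ≤ (T : ℝ) * l * Δ := by
    have := mul_le_mul_of_nonneg_right hu2 hΔ; linarith
  have hD2 : (T : ℝ) * l * Δ ≤ s * Δ + 2 * l * Δ := by
    have := mul_le_mul_of_nonneg_right hu1 hΔ; linarith
  have key1 : (T : ℝ) * -(Δ * l - C * l ^ 2) ≤ -s * Δ + ρ := by
    have : (T : ℝ) * -(Δ * l - C * l ^ 2) = C * ((T : ℝ) * l) * l - (T : ℝ) * l * Δ := by ring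
    rw [this, hρexp]; linarith
  have key2 : -s * Δ - ρ ≤ (T : ℝ) * -(Δ * l + C * l ^ 2) := by
    have : (T : ℝ) * -(Δ * l + C * l ^ 2) = -(C * ((T : ℝ) * l) * l) - (T : ℝ) * l * Δ := by ring
    rw [this, hρexp]; linarith
  have hxT_up : x ^ T ≤ Real.exp (-s * Δ + ρ) := hTup.trans (Real.exp_le_exp.2 key1)
  have hxT_low : Real.exp (-s * Δ - ρ) ≤ x ^ T := (Real.exp_le_exp.2 key2).trans hTlow
  have hE : Real.exp (-s * Δ) ≤ 1 := by
    rw [Real.exp_le_one_iff]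
    have : 0 ≤ s * Δ := mul_nonneg hs.le hΔ
    linarith
  have hEpos : 0 < Real.exp (-s * Δ) := Real.exp_pos _
  have hEρ : Real.exp (-s * Δ) * ρ ≤ ρ := mul_le_of_le_one_left hρ0 hE
  rw [abs_le]
  constructor
  · have h1 : Real.exp (-s * Δ - ρ) = Real.exp (-s * Δ) * Real.exp (-ρ) := by
      rw [sub_eq_add_neg, Real.exp_add]
    have h2 : 1 - ρ ≤ Real.exp (-ρ) := by have := Real.add_one_le_exp (-ρ); linarith
    have h3 : Real.exp (-s * Δ) * (1 - ρ) ≤ x ^ T := by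
      calc Real.exp (-s * Δ) * (1 - ρ) ≤ Real.exp (-s * Δ) * Real.exp (-ρ) :=
            mul_le_mul_of_nonneg_left h2 hEpos.le
        _ = Real.exp (-s * Δ - ρ) := h1.symm
        _ ≤ x ^ T := hxT_low
    have h4 : Real.exp (-s * Δ) * (1 - ρ) = Real.exp (-s * Δ) - Real.exp (-s * Δ) * ρ := by ring
    linarith
  · have h1 : Real.exp (-s * Δ + ρ) = Real.exp (-s * Δ) * Real.exp ρ := Real.exp_add _ _
    have h2 : Real.exp ρ ≤ 1 + 2 * ρ := by
      have hh := Real.abs_exp_sub_one_le (x := ρ) (by rw [abs_of_nonneg hρ0]; exact hρ1)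
      rw [abs_of_nonneg hρ0] at hh
      have := (abs_le.1 hh).2; linarith
    have h3 : x ^ T ≤ Real.exp (-s * Δ) * (1 + 2 * ρ) :=
      hxT_up.trans (by rw [h1]; exact mul_le_mul_of_nonneg_left h2 hEpos.le)
    have h4 : Real.exp (-s * Δ) * (1 + 2 * ρ) = Real.exp (-s * Δ) + 2 * (Real.exp (-s * Δ) * ρ) := by ring
    linarith

/-- **Uniform moment limit.**  `|m_B(T) − Σ_k e^{−sΔ_k}| ≤ ε` for `B ≥ B2(s, ε)` and every `T` with `|Tλ_b − s| ≤ 2λ_b` (the tolerance `2λ_b` covers both `T` and `2T`). -/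
theorem moment_close (hONE : Summit.QuantumFields.YangMills.Theses.LuscherReduction.OneSiteLevels)
    (hLG : ∀ s : ℝ, 0 < s → Summable fun k : ℕ => Real.exp (-s * levelGap k))
    (hTail : Summit.QuantumFields.YangMills.Theses.LuscherReduction.OneSiteTail) {s : ℝ} (hs : 0 < s) {ε : ℝ} (hε : 0 < ε) :
    ∃ B2 : ℝ, ∀ B : ℝ, B2 ≤ B → ∀ T : ℕ, |(T : ℝ) * bareLambda B - s| ≤ 2 * bareLambda B →
      Summable (fun k : ℕ => (levelValue su2Rep 1 B k / levelValue su2Rep 1 B 0) ^ T) ∧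
      |(∑' k : ℕ, (levelValue su2Rep 1 B k / levelValue su2Rep 1 B 0) ^ T) - ∑' k : ℕ, Real.exp (-s * levelGap k)| ≤ ε := by
  have hε4 : 0 < ε / 4 := by positivity
  have hM : Summable (fun k => Real.exp (-s * levelGap k)) := hLG s hs
  have hMtail : ∀ᶠ i : ℕ in atTop, ∑' k, Real.exp (-s * levelGap (k + i)) < ε / 4 :=
    (tendsto_sum_nat_add (fun k => Real.exp (-s * levelGap k))).eventually (eventually_lt_nhds hε4)
  obtain ⟨N, hN⟩ := Filter.eventually_atTop.1 hMtail
  obtain ⟨K1, B1, hT1⟩ := hTail s hs (ε / 4) hε4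
  set K : ℕ := K1 + N with hK
  have hε' : 0 < ε / (4 * ((K : ℝ) + 1)) := by positivity
  choose Bk hBk using fun k => term_close hONE k hs hε'
  set B3 : ℝ := ∑ k ∈ Finset.range K, max (Bk k) 0 with hB3
  have hs8 : 0 < s / 8 := by positivity
  refine ⟨max (max B1 B3) (max 1 (2 / (s / 8) ^ 3)), fun B hB T hT => ?_⟩
  have hB1 : B1 ≤ B := le_trans ((le_max_left _ _).trans (le_max_left _ _)) hB
  have hB3' : B3 ≤ B := le_trans ((le_max_right _ _).trans (le_max_left _ _)) hB
  have hBone : 1 ≤ B := le_trans ((le_max_left _ _).trans (le_max_right _ _)) hB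
  have hBs : 2 / (s / 8) ^ 3 ≤ B := le_trans ((le_max_right _ _).trans (le_max_right _ _)) hB
  have hl : bareLambda B ≤ s / 8 := bareLambda_le_of_le hs8 hBs
  have hlpos : 0 < bareLambda B := bareLambda_pos' (by linarith)
  have hwin : s ≤ 2 * ((T : ℝ) * bareLambda B) := by have := (abs_le.1 hT).1; linarith
  obtain ⟨hsum, htail⟩ := hT1 B hB1 T hwin
  refine ⟨hsum, ?_⟩
  set f : ℕ → ℝ := fun k => (levelValue su2Rep 1 B k / levelValue su2Rep 1 B 0) ^ T with hf
  set g : ℕ → ℝ := fun k => Real.exp (-s * levelGap k) with hg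
  have hB0' : (0 : ℝ) ≤ B := by linarith
  have hf0 : ∀ k, 0 ≤ f k := fun k =>
    pow_nonneg (div_nonneg (levelValue_su2Rep_nonneg 1 hB0' k) (levelValue_su2Rep_nonneg 1 hB0' 0)) T
  have hg0 : ∀ k, 0 ≤ g k := fun k => (Real.exp_pos _).le
  have hfdec := hsum.sum_add_tsum_nat_add K
  have hgdec := hM.sum_add_tsum_nat_add K
  have hftail : ∑' i, f (i + K) ≤ ε / 4 := (tsum_shift_le hsum hf0 K1 N).trans htail
  have hgtail : ∑' i, g (i + K) < ε / 4 := hN K (by omega)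
  have hftail0 : 0 ≤ ∑' i, f (i + K) := tsum_nonneg fun i => hf0 _
  have hgtail0 : 0 ≤ ∑' i, g (i + K) := tsum_nonneg fun i => hg0 _
  have hfin : ∑ k ∈ Finset.range K, |f k - g k| ≤ ∑ k ∈ Finset.range K, ε / (4 * ((K : ℝ) + 1)) := by
    refine Finset.sum_le_sum fun k hk => ?_
    have hBk' : Bk k ≤ B := by
      have h1 : max (Bk k) 0 ≤ B3 :=
        Finset.single_le_sum (f := fun k => max (Bk k) 0) (fun i _ => le_max_right _ _) hk
      exact le_trans (le_max_left _ _) (h1.trans hB3')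
    exact hBk k B hBk' T hT
  have hfin' : ∑ k ∈ Finset.range K, |f k - g k| ≤ ε / 4 := by
    refine hfin.trans ?_
    rw [Finset.sum_const, Finset.card_range, nsmul_eq_mul]
    have hK1 : (0 : ℝ) < (K : ℝ) + 1 := by positivity
    rw [show (K : ℝ) * (ε / (4 * ((K : ℝ) + 1))) = ε / 4 * ((K : ℝ) / ((K : ℝ) + 1)) by
      field_simp]
    have : (K : ℝ) / ((K : ℝ) + 1) ≤ 1 := by rw [div_le_one hK1]; linarith
    calc ε / 4 * ((K : ℝ) / ((K : ℝ) + 1)) ≤ ε / 4 * 1 := mul_le_mul_of_nonneg_left this hε4.le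
      _ = ε / 4 := mul_one _
  have hfinabs : |∑ k ∈ Finset.range K, f k - ∑ k ∈ Finset.range K, g k| ≤ ε / 4 := by
    rw [← Finset.sum_sub_distrib]; exact (Finset.abs_sum_le_sum_abs _ _).trans hfin'
  rw [← hfdec, ← hgdec]
  have hsplit : (∑ k ∈ Finset.range K, f k + ∑' i, f (i + K)) - (∑ k ∈ Finset.range K, g k + ∑' i, g (i + K)) =
      (∑ k ∈ Finset.range K, f k - ∑ k ∈ Finset.range K, g k) + (∑' i, f (i + K) - ∑' i, g (i + K)) := by ring
  rw [hsplit]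
  calc |(∑ k ∈ Finset.range K, f k - ∑ k ∈ Finset.range K, g k) + (∑' i, f (i + K) - ∑' i, g (i + K))|
      ≤ |∑ k ∈ Finset.range K, f k - ∑ k ∈ Finset.range K, g k| + |∑' i, f (i + K) - ∑' i, g (i + K)| := abs_add_le _ _
    _ ≤ ε / 4 + (ε / 4 + ε / 4) := add_le_add hfinabs (by rw [abs_le]; constructor <;> linarith)
    _ ≤ ε := by linarith

/-- ★ **`OneSiteTraceLimit` from ONE + `LevelGapSummable` + `OneSiteTail`** (PROVED). -/
theorem oneSiteTraceLimit_of_ONE (hONE : Summit.QuantumFields.YangMills.Theses.LuscherReduction.OneSiteLevels)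
    (hLG : ∀ s : ℝ, 0 < s → Summable fun k : ℕ => Real.exp (-s * levelGap k))
    (hTail : Summit.QuantumFields.YangMills.Theses.LuscherReduction.OneSiteTail) :
    (∀ s : ℝ, 0 < s → ∀ ε : ℝ, 0 < ε → ∃ B0 : ℝ, ∀ B : ℝ, B0 ≤ B → ∀ T : ℕ,
      |(T : ℝ) * bareLambda B - s| ≤ bareLambda B → |levelRatio 1 B T - hTraceRatio s| ≤ ε) := by
  intro s hs ε hε
  have hε3 : 0 < ε / 3 := by positivity
  have h2s : 0 < 2 * s := by positivity
  obtain ⟨B2, h2⟩ := moment_close hONE hLG hTail hs hε3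
  obtain ⟨B2', h2'⟩ := moment_close hONE hLG hTail h2s hε3
  refine ⟨max (max B2 B2') 1, fun B hB T hT => ?_⟩
  have hB2 : B2 ≤ B := le_trans ((le_max_left _ _).trans (le_max_left _ _)) hB
  have hB2' : B2' ≤ B := le_trans ((le_max_right _ _).trans (le_max_left _ _)) hB
  have hBone : 1 ≤ B := le_trans (le_max_right _ _) hB
  have hlpos : 0 < bareLambda B := bareLambda_pos' (by linarith)
  have hT1 : |(T : ℝ) * bareLambda B - s| ≤ 2 * bareLambda B := hT.trans (by linarith)
  have hT2 : |((2 * T : ℕ) : ℝ) * bareLambda B - 2 * s| ≤ 2 * bareLambda B := by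
    push_cast
    rw [show (2 : ℝ) * (T : ℝ) * bareLambda B - 2 * s = 2 * ((T : ℝ) * bareLambda B - s) by ring, abs_mul,
      abs_of_pos (by norm_num : (0 : ℝ) < 2)]
    linarith
  obtain ⟨hsum1, hm1⟩ := h2 B hB2 T hT1
  obtain ⟨hsum2, hm2⟩ := h2' B hB2' (2 * T) hT2
  have hB0' : (0 : ℝ) ≤ B := by linarith
  have hone : 1 ≤ ∑' k : ℕ, (levelValue su2Rep 1 B k / levelValue su2Rep 1 B 0) ^ T := by
    have h := hsum1.le_tsum 0 (fun j _ =>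
      pow_nonneg (div_nonneg (levelValue_su2Rep_nonneg 1 hB0' j) (levelValue_su2Rep_nonneg 1 hB0' 0)) T)
    have h0 : (levelValue su2Rep 1 B 0 / levelValue su2Rep 1 B 0) ^ T = 1 := by
      rw [div_self (levelValue_zero_su2Rep_pos 1 B).ne', one_pow]
    rw [h0] at h; exact h
  have hone' : 1 ≤ ∑' k : ℕ, Real.exp (-s * levelGap k) := by
    have h := (hLG s hs).le_tsum 0 (fun j _ => (Real.exp_pos _).le)
    rw [levelGap_zero, mul_zero, Real.exp_zero] at h; exact h
  have hA' : 0 ≤ ∑' k : ℕ, Real.exp (-(2 * s) * levelGap k) := tsum_nonneg fun k => (Real.exp_pos _).le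
  have hA'B' : ∑' k : ℕ, Real.exp (-(2 * s) * levelGap k) ≤ ∑' k : ℕ, Real.exp (-s * levelGap k) := by
    refine Summable.tsum_le_tsum (fun k => ?_) (hLG (2 * s) h2s) (hLG s hs)
    refine Real.exp_le_exp.2 ?_
    have : 0 ≤ s * levelGap k := mul_nonneg hs.le (levelGap_nonneg k)
    linarith
  show |(∑' k : ℕ, (levelValue su2Rep 1 B k / levelValue su2Rep 1 B 0) ^ (2 * T)) /
      (∑' k : ℕ, (levelValue su2Rep 1 B k / levelValue su2Rep 1 B 0) ^ T) ^ 2 -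
      (∑' k : ℕ, Real.exp (-(2 * s) * levelGap k)) / (∑' k : ℕ, Real.exp (-s * levelGap k)) ^ 2| ≤ ε
  refine (ratio_sub_ratio_le hone hone' hA' hA'B').trans ?_
  linarith [hm1, hm2]

end OST

/-- `OneSiteTraceLimit` from the child `OneSiteTail` alone (ONE closed, `LevelGapSummable` a tree theorem). -/
theorem oneSiteTraceLimit_of_oneSiteTail (hTail : Summit.QuantumFields.YangMills.Theses.LuscherReduction.OneSiteTail) :
    (∀ s : ℝ, 0 < s → ∀ ε : ℝ, 0 < ε → ∃ B0 : ℝ, ∀ B : ℝ, B0 ≤ B → ∀ T : ℕ,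
      |(T : ℝ) * bareLambda B - s| ≤ bareLambda B → |levelRatio 1 B T - hTraceRatio s| ≤ ε) :=
  OST.oneSiteTraceLimit_of_ONE Summit.QuantumFields.YangMills.Theorems.FemtoTransferGap.oneSiteLevels_proof
    Summit.QuantumFields.YangMills.Theorems.FemtoTransferGap.LGS.levelGapSummable_all hTail

end Summit.QuantumFields.YangMills.Theorems.FemtoTransferGap.TraceDoor

end
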